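import Mathlib

/-!
# SigmaRowCover — the KÖNIG ∕ vertex-cover step of ROW Σ-H, typed (hsemireg-monad-3 g4, memo `B1PROPER-monad3-g4.md` §2)

Evidence-only crux workfile on `stmt-HodgeConjecture-18881` (D-0145 token: line stmt-HodgeConjecture-18881
Cruxes/BlochSeedDiscOne/Lines/birth.lean 814a6a70c14e831a stub_rung_pad4_seedAt (helper)).  An inequality of dimensions ≠ a
sheaf ≠ semiregular ≠ a SEED.  NOTHING here is proved toward HC ∕ HC_CM ∕ HC_AV ∕ №4 ∕ 26512 ∕ 18881 ∕ H2.

`SigmaRowSpec.lean` (hsemireg-c4-1 g5) types the floor `sigmaH_floor : dim I ≤ dim H + dim N + rank (p ∘ f)` (F4) and says that the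
step `rank (P_I ∘ d_in) ≤ weighted minimum vertex cover of the block pattern` is NOT typed.  This file types it (`import Mathlib` only; section `floor` —
`imInKer`, `ker_restrict_floor`, `sigmaH_floor`, `sigmaK_floor` — is re-declared VERBATIM from `SigmaRowSpec.lean` inside this file's namespace so that the
farm check does not wait on that module's build (a first version importing it got rc 75 `remote:stale:1:unbuilt:…SigmaRowSpec` on 2026-08-29); the
declarations are syntactically identical, as c4-1 did with strengthen g6's `EinfRow.imInKer`):

* `finrank_range_le_cover` — BLOCK RANK ≤ WEIGHTED VERTEX COVER: if `f : (Π a, Uₐ) → (Π b, V_b)` has zero block entry `(b, a)` whenever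
  `b ∉ C_V` and `a ∉ C_U` (i.e. `(C_V, C_U)` is a vertex cover of the block-support graph of `f`), then
  `rank f ≤ Σ_{b ∈ C_V} dim V_b + Σ_{a ∈ C_U} dim U_a`;  `finrank_range_le_vertexCover` is the same with an explicit support relation `E`.
  (Only this direction of König–Egerváry is used by the machine row: EVERY cover certificate bounds the rank, in particular the minimum one.)
* `sigmaH_floor_cover` — (F4) with `I` = the blocks in `S`, `p` = the block projection onto `S`, and the rank term replaced by the weight of any
  vertex cover of the block pattern of `P_S ∘ f`:  `Σ_{b ∈ S} dim V_b ≤ dim H + dim N + cover weight`.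
* `sigmaH_floor_blocks` — additionally `W = Π c, W_c`, `g` block-supported on `F`, `T ⊇ F(S)` the blocks reached from `S`:
  `Σ_{b ∈ S} dim V_b ≤ dim H + Σ_{c ∈ T} dim W_c + cover weight`, i.e. the machine's
  `dim H ≥ w(I) − w(N(I)) − minVC(P_I d_in)` holds in the kernel for every certificate `(S, T, C_V, C_U)` once the block-support laws of `d_in = f` and
  `d_out = g` are granted (those laws — the HPL ∕ Künneth support law of the differentials — and the identification of `U, V, W` with the `Ext`-groups
  remain HYPOTHESES of the machine row; pen (F1)–(F3) of c4-1's memo; nothing about them is claimed here).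
-/

set_option linter.dupNamespace false
set_option autoImplicit false

namespace Summit.HodgeConjecture.HodgeConjecture.Cruxes.BlochSeedDiscOne.SigmaRowCover

open Module

/-! ## Section `floor` — verbatim from `SigmaRowSpec.lean` (hsemireg-c4-1 g5), see the module docstring -/
section floor
variable {K : Type*} [Field K] {U V W : Type*}
  [AddCommGroup U] [Module K U] [FiniteDimensional K U]
  [AddCommGroup V] [Module K V] [FiniteDimensional K V]
  [AddCommGroup W] [Module K W] [FiniteDimensional K W]

/-- The image of `f` inside `ker g`, for a complex `U →f V →g W` (verbatim `EinfRow.imInKer` of `StrengthenEinfRow`). -/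
def imInKer (f : U →ₗ[K] V) (g : V →ₗ[K] W) (hfg : ∀ u, g (f u) = 0) : Submodule K (LinearMap.ker g) :=
  LinearMap.range (LinearMap.codRestrict (LinearMap.ker g) f (fun u => by simpa [LinearMap.mem_ker] using hfg u))

/-- KERNEL-DEFICIENCY STEP: if `g` maps `I` into `N` then `dim (ker g ⊓ I) ≥ dim I − dim N`
(stated on the restriction `gI : I → N`: `dim I ≤ dim ker gI + dim N`). -/
theorem ker_restrict_floor (g : V →ₗ[K] W) (I : Submodule K V) (N : Submodule K W) (hIN : ∀ v ∈ I, g v ∈ N) :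
    finrank K I ≤ finrank K (LinearMap.ker (LinearMap.codRestrict N (g ∘ₗ I.subtype) (fun v => hIN v v.2)))
      + finrank K N := by
  set gI := LinearMap.codRestrict N (g ∘ₗ I.subtype) (fun v => hIN v v.2)
  have h1 : finrank K (LinearMap.range gI) + finrank K (LinearMap.ker gI) = finrank K I :=
    LinearMap.finrank_range_add_finrank_ker gI
  have h2 : finrank K (LinearMap.range gI) ≤ finrank K N := Submodule.finrank_le _
  omega

/-- ROW Σ-H FLOOR (F4): for a complex `U →f V →g W`, a subspace `I ≤ V` with `g(I) ≤ N`, and `p : V → V` fixing `I` pointwise,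
`dim I ≤ dim (ker g ⧸ im f) + dim N + rank (p ∘ f)`. -/
theorem sigmaH_floor (f : U →ₗ[K] V) (g : V →ₗ[K] W) (hfg : ∀ u, g (f u) = 0)
    (I : Submodule K V) (N : Submodule K W) (hIN : ∀ v ∈ I, g v ∈ N)
    (p : V →ₗ[K] V) (hp : ∀ v ∈ I, p v = v) :
    finrank K I ≤ finrank K (LinearMap.ker g ⧸ imInKer f g hfg) + finrank K N
      + finrank K (LinearMap.range (p ∘ₗ f)) := by
  -- the restriction gI : I → N and its kernel
  set gI := LinearMap.codRestrict N (g ∘ₗ I.subtype) (fun v => hIN v v.2) with hgI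
  have hA : finrank K I ≤ finrank K (LinearMap.ker gI) + finrank K N := ker_restrict_floor g I N hIN
  -- elements of ker gI are elements of ker g
  have hker : ∀ v : LinearMap.ker gI, g ((v : I) : V) = 0 := by
    intro v
    have hv : gI (v : I) = 0 := LinearMap.mem_ker.mp v.2
    exact congrArg Subtype.val hv
  let toKer : LinearMap.ker gI →ₗ[K] LinearMap.ker g :=
    { toFun := fun v => ⟨((v : I) : V), by rw [LinearMap.mem_ker]; exact hker v⟩
      map_add' := by intro a b; ext; simp
      map_smul' := by intro c a; ext; simp }
  have toKer_val : ∀ v : LinearMap.ker gI, ((toKer v : LinearMap.ker g) : V) = ((v : I) : V) := fun v => rfl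
  -- ψ : ker gI → H = ker g ⧸ im f
  let ψ : LinearMap.ker gI →ₗ[K] (LinearMap.ker g ⧸ imInKer f g hfg) := (imInKer f g hfg).mkQ ∘ₗ toKer
  have hB : finrank K (LinearMap.range ψ) + finrank K (LinearMap.ker ψ) = finrank K (LinearMap.ker gI) :=
    LinearMap.finrank_range_add_finrank_ker ψ
  have hC : finrank K (LinearMap.range ψ) ≤ finrank K (LinearMap.ker g ⧸ imInKer f g hfg) := Submodule.finrank_le _
  -- ker ψ embeds into range (p ∘ f): an element of I ∩ ker g that is a boundary f u equals p (f u)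
  have hmem : ∀ v : LinearMap.ker ψ, (((v : LinearMap.ker gI) : I) : V) ∈ LinearMap.range (p ∘ₗ f) := by
    intro v
    have hv : ψ (v : LinearMap.ker gI) = 0 := LinearMap.mem_ker.mp v.2
    have hv' : toKer (v : LinearMap.ker gI) ∈ imInKer f g hfg := (Submodule.Quotient.mk_eq_zero _).mp hv
    obtain ⟨u, hu⟩ := hv'
    have hu' : f u = (((v : LinearMap.ker gI) : I) : V) := congrArg Subtype.val hu
    refine ⟨u, ?_⟩
    rw [LinearMap.comp_apply, hu', hp _ ((v : LinearMap.ker gI) : I).2]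
  let j : LinearMap.ker ψ →ₗ[K] LinearMap.range (p ∘ₗ f) :=
    { toFun := fun v => ⟨(((v : LinearMap.ker gI) : I) : V), hmem v⟩
      map_add' := by intro a b; ext; simp
      map_smul' := by intro c a; ext; simp }
  have hj : Function.Injective j := by
    intro a b hab
    have h := congrArg Subtype.val hab
    apply Subtype.ext; apply Subtype.ext; apply Subtype.ext
    exact h
  have hD : finrank K (LinearMap.ker ψ) ≤ finrank K (LinearMap.range (p ∘ₗ f)) :=
    LinearMap.finrank_le_finrank_of_injective hj
  omega

/-- The `I = V` specialisation is strengthen's whole-row floor (ROW Σ-K per multidegree): `dim V ≤ dim H + dim W + rank f`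
(and `rank f ≤ dim U`). -/
theorem sigmaK_floor (f : U →ₗ[K] V) (g : V →ₗ[K] W) (hfg : ∀ u, g (f u) = 0) :
    finrank K V ≤ finrank K (LinearMap.ker g ⧸ imInKer f g hfg) + finrank K W + finrank K (LinearMap.range f) := by
  have h := sigmaH_floor f g hfg ⊤ ⊤ (fun v _ => Submodule.mem_top) LinearMap.id (fun v _ => rfl)
  have h1 : finrank K (⊤ : Submodule K V) = finrank K V := finrank_top K V
  have h2 : finrank K (⊤ : Submodule K W) = finrank K W := finrank_top K W
  have h3 : (LinearMap.id ∘ₗ f : U →ₗ[K] V) = f := LinearMap.id_comp f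
  rw [h1, h2, h3] at h
  exact h

end floor

section blocks
variable (K : Type*) [Field K]
variable {ι : Type*}
variable (Vb : ι → Type*) [∀ b, AddCommGroup (Vb b)] [∀ b, Module K (Vb b)]

/-- Restriction to the blocks in `S`. -/
def resOn (S : Finset ι) : (Π b, Vb b) →ₗ[K] (Π b : S, Vb b) where
  toFun v b := v b
  map_add' _ _ := rfl
  map_smul' _ _ := rfl

theorem resOn_apply (S : Finset ι) (v : Π b, Vb b) (b : S) : resOn K Vb S v b = v b := rfl

variable [DecidableEq ι]

/-- Extension by zero from the blocks in `S`. -/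
def extOn (S : Finset ι) : (Π b : S, Vb b) →ₗ[K] (Π b, Vb b) where
  toFun w b := if h : b ∈ S then w ⟨b, h⟩ else 0
  map_add' w w' := by
    funext b
    by_cases h : b ∈ S
    · simp [h]
    · simp [h]
  map_smul' c w := by
    funext b
    by_cases h : b ∈ S
    · simp [h]
    · simp [h]

/-- Projection onto the blocks in `S` along the other blocks (`P_S`). -/
def projOn (S : Finset ι) : (Π b, Vb b) →ₗ[K] (Π b, Vb b) where
  toFun v b := if b ∈ S then v b else 0
  map_add' v v' := by
    funext b
    by_cases h : b ∈ S
    · simp [h]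
    · simp [h]
  map_smul' c v := by
    funext b
    by_cases h : b ∈ S
    · simp [h]
    · simp [h]

theorem extOn_apply (S : Finset ι) (w : Π b : S, Vb b) (b : ι) :
    extOn K Vb S w b = if h : b ∈ S then w ⟨b, h⟩ else 0 := rfl

theorem projOn_apply (S : Finset ι) (v : Π b, Vb b) (b : ι) :
    projOn K Vb S v b = if b ∈ S then v b else 0 := rfl

theorem projOn_eq_extOn_resOn (S : Finset ι) (v : Π b, Vb b) :
    projOn K Vb S v = extOn K Vb S (resOn K Vb S v) := by
  funext b
  rw [projOn_apply, extOn_apply]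
  by_cases h : b ∈ S
  · rw [if_pos h, dif_pos h]; rfl
  · rw [if_neg h, dif_neg h]

theorem extOn_injective (S : Finset ι) : Function.Injective (extOn K Vb S) := by
  intro w w' h
  funext b
  have hb := congrFun h b
  rw [extOn_apply, extOn_apply, dif_pos b.2, dif_pos b.2] at hb
  exact hb

/-- `v` is in the image of the extension by zero from `S` iff it vanishes on every block outside `S`. -/
theorem mem_range_extOn (S : Finset ι) (v : Π b, Vb b) :
    v ∈ LinearMap.range (extOn K Vb S) ↔ ∀ b, b ∉ S → v b = 0 := by
  constructor
  · rintro ⟨w, rfl⟩ b hb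
    rw [extOn_apply, dif_neg hb]
  · intro h
    refine ⟨resOn K Vb S v, ?_⟩
    funext b
    rw [extOn_apply]
    by_cases hb : b ∈ S
    · rw [dif_pos hb]; rfl
    · rw [dif_neg hb, h b hb]

/-- `P_S` fixes the blocks in `S` pointwise. -/
theorem projOn_eq_self_of_mem (S : Finset ι) (v : Π b, Vb b) (hv : v ∈ LinearMap.range (extOn K Vb S)) :
    projOn K Vb S v = v := by
  rw [mem_range_extOn] at hv
  funext b
  rw [projOn_apply]
  by_cases hb : b ∈ S
  · rw [if_pos hb]
  · rw [if_neg hb, hv b hb]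

variable [∀ b, FiniteDimensional K (Vb b)]

/-- The blocks in `S` have total dimension `Σ_{b ∈ S} dim V_b`. -/
theorem finrank_range_extOn (S : Finset ι) :
    finrank K (LinearMap.range (extOn K Vb S)) = ∑ b ∈ S, finrank K (Vb b) := by
  rw [LinearMap.finrank_range_of_inj (extOn_injective K Vb S), Module.finrank_pi_fintype]
  exact (Finset.sum_subtype S (fun _ => Iff.rfl) (fun b => finrank K (Vb b))).symm

end blocks

section cover
variable (K : Type*) [Field K]
variable {ι κ : Type*} [Fintype ι] [Fintype κ] [DecidableEq ι] [DecidableEq κ]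
variable {Vb : ι → Type*} [∀ b, AddCommGroup (Vb b)] [∀ b, Module K (Vb b)] [∀ b, FiniteDimensional K (Vb b)]
variable {Ua : κ → Type*} [∀ a, AddCommGroup (Ua a)] [∀ a, Module K (Ua a)] [∀ a, FiniteDimensional K (Ua a)]

omit [Fintype ι] [DecidableEq ι] [∀ b, FiniteDimensional K (Vb b)] [∀ a, FiniteDimensional K (Ua a)] in
/-- Block evaluation: if, for every block column `a`, either `v` has zero `a`-component or the block entry `(b, a)` of `f` is zero,
then `(f v)_b = 0`. -/
theorem apply_eq_zero_of_blocks (f : (Π a, Ua a) →ₗ[K] (Π b, Vb b)) (v : Π a, Ua a) (b : ι)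
    (h : ∀ a, v a = 0 ∨ ∀ x : Ua a, f (Pi.single a x) b = 0) : f v b = 0 := by
  rw [← Finset.univ_sum_single v, map_sum, Finset.sum_apply]
  refine Finset.sum_eq_zero (fun a _ => ?_)
  rcases h a with h0 | hx
  · rw [h0, Pi.single_zero, map_zero]; rfl
  · exact hx _

/-- BLOCK RANK ≤ WEIGHTED VERTEX COVER.  If the block entry `(b, a)` of `f : (Π a, U_a) → (Π b, V_b)` vanishes whenever `b ∉ C_V` and
`a ∉ C_U` — `(C_V, C_U)` covers the block-support graph of `f` — then `rank f ≤ Σ_{b ∈ C_V} dim V_b + Σ_{a ∈ C_U} dim U_a`. -/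
theorem finrank_range_le_cover (f : (Π a, Ua a) →ₗ[K] (Π b, Vb b)) (CV : Finset ι) (CU : Finset κ)
    (hcov : ∀ b a, b ∉ CV → a ∉ CU → ∀ x : Ua a, f (Pi.single a x) b = 0) :
    finrank K (LinearMap.range f) ≤ ∑ b ∈ CV, finrank K (Vb b) + ∑ a ∈ CU, finrank K (Ua a) := by
  -- the part of `u` on the columns outside `C_U` is mapped into the rows in `C_V`
  have hu' : ∀ u : Π a, Ua a, ∀ b, b ∉ CV → f (u - extOn K Ua CU (resOn K Ua CU u)) b = 0 := by
    intro u b hb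
    refine apply_eq_zero_of_blocks K f _ b (fun a => ?_)
    by_cases ha : a ∈ CU
    · left
      show u a - extOn K Ua CU (resOn K Ua CU u) a = 0
      rw [extOn_apply, dif_pos ha, resOn_apply, sub_self]
    · right
      exact hcov b a hb ha
  have hle : LinearMap.range f ≤
      LinearMap.range (f ∘ₗ extOn K Ua CU) ⊔ LinearMap.range (extOn K Vb CV) := by
    rintro _ ⟨u, rfl⟩
    have hdec : f u = f (extOn K Ua CU (resOn K Ua CU u)) + f (u - extOn K Ua CU (resOn K Ua CU u)) := by
      rw [← map_add]; congr 1; abel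
    rw [hdec]
    refine Submodule.add_mem_sup ⟨resOn K Ua CU u, rfl⟩ ?_
    rw [mem_range_extOn]
    exact hu' u
  have h1 : finrank K (LinearMap.range (f ∘ₗ extOn K Ua CU)) ≤ ∑ a ∈ CU, finrank K (Ua a) := by
    calc finrank K (LinearMap.range (f ∘ₗ extOn K Ua CU)) ≤ finrank K (Π a : CU, Ua a) :=
          LinearMap.finrank_range_le _
      _ = ∑ a ∈ CU, finrank K (Ua a) := by
          rw [Module.finrank_pi_fintype]
          exact (Finset.sum_subtype CU (fun _ => Iff.rfl) (fun a => finrank K (Ua a))).symm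
  have h2 : finrank K (LinearMap.range (extOn K Vb CV)) = ∑ b ∈ CV, finrank K (Vb b) := finrank_range_extOn K Vb CV
  have h3 := Submodule.finrank_mono hle
  have h4 := Submodule.finrank_sup_add_finrank_inf_eq (LinearMap.range (f ∘ₗ extOn K Ua CU))
    (LinearMap.range (extOn K Vb CV))
  omega

/-- The same with an explicit block-support relation `E` (`E b a` = "block entry `(b, a)` may be non-zero") and a vertex cover `(C_V, C_U)` of `E`. -/
theorem finrank_range_le_vertexCover (f : (Π a, Ua a) →ₗ[K] (Π b, Vb b)) (E : ι → κ → Prop)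
    (hE : ∀ b a, ¬ E b a → ∀ x : Ua a, f (Pi.single a x) b = 0)
    (CV : Finset ι) (CU : Finset κ) (hcov : ∀ b a, E b a → b ∈ CV ∨ a ∈ CU) :
    finrank K (LinearMap.range f) ≤ ∑ b ∈ CV, finrank K (Vb b) + ∑ a ∈ CU, finrank K (Ua a) :=
  finrank_range_le_cover K f CV CU (fun b a hb ha x => hE b a (fun h => (hcov b a h).elim hb ha) x)

variable {W : Type*} [AddCommGroup W] [Module K W] [FiniteDimensional K W]

/-- ROW Σ-H FLOOR WITH A COVER CERTIFICATE.  For a complex `(Π a, U_a) →f (Π b, V_b) →g W`, a set `S` of middle blocks with `g(blocks S) ≤ N`,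
and `(C_V, C_U)` covering the block pattern of `P_S ∘ f` (zero block entry `(b, a)` of `f` whenever `b ∈ S`, `b ∉ C_V`, `a ∉ C_U`):
`Σ_{b ∈ S} dim V_b ≤ dim (ker g ⧸ im f) + dim N + (Σ_{b ∈ C_V} dim V_b + Σ_{a ∈ C_U} dim U_a)`. -/
theorem sigmaH_floor_cover (f : (Π a, Ua a) →ₗ[K] (Π b, Vb b)) (g : (Π b, Vb b) →ₗ[K] W) (hfg : ∀ u, g (f u) = 0)
    (S : Finset ι) (N : Submodule K W) (hIN : ∀ v ∈ LinearMap.range (extOn K Vb S), g v ∈ N)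
    (CV : Finset ι) (CU : Finset κ)
    (hcov : ∀ b a, b ∈ S → b ∉ CV → a ∉ CU → ∀ x : Ua a, f (Pi.single a x) b = 0) :
    ∑ b ∈ S, finrank K (Vb b) ≤ finrank K (LinearMap.ker g ⧸ imInKer f g hfg) + finrank K N
      + (∑ b ∈ CV, finrank K (Vb b) + ∑ a ∈ CU, finrank K (Ua a)) := by
  have hfloor := sigmaH_floor f g hfg (LinearMap.range (extOn K Vb S)) N hIN (projOn K Vb S)
    (fun v hv => projOn_eq_self_of_mem K Vb S v hv)
  rw [finrank_range_extOn] at hfloor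
  have hrank : finrank K (LinearMap.range (projOn K Vb S ∘ₗ f)) ≤
      ∑ b ∈ CV, finrank K (Vb b) + ∑ a ∈ CU, finrank K (Ua a) := by
    refine finrank_range_le_cover K (projOn K Vb S ∘ₗ f) CV CU (fun b a hb ha x => ?_)
    rw [LinearMap.comp_apply, projOn_apply]
    by_cases hS : b ∈ S
    · rw [if_pos hS]; exact hcov b a hS hb ha x
    · rw [if_neg hS]
  omega

variable {γ : Type*} [Fintype γ] [DecidableEq γ]
variable {Wc : γ → Type*} [∀ c, AddCommGroup (Wc c)] [∀ c, Module K (Wc c)] [∀ c, FiniteDimensional K (Wc c)]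

/-- THE MACHINE ROW, ALL BLOCKS.  Complex `(Π a, U_a) →f (Π b, V_b) →g (Π c, W_c)`; `S` = the chosen middle blocks (`I`); `T` ⊇ the blocks of `W`
reached from `S` by non-zero block entries of `g` (`N(I)`); `(C_V, C_U)` a cover of the block pattern of `P_S ∘ f`.  Then
`Σ_{b ∈ S} dim V_b ≤ dim (ker g ⧸ im f) + Σ_{c ∈ T} dim W_c + (Σ_{b ∈ C_V} dim V_b + Σ_{a ∈ C_U} dim U_a)`,
i.e. `dim H ≥ w(I) − w(N(I)) − cover weight` for EVERY certificate `(S, T, C_V, C_U)`. -/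
theorem sigmaH_floor_blocks (f : (Π a, Ua a) →ₗ[K] (Π b, Vb b)) (g : (Π b, Vb b) →ₗ[K] (Π c, Wc c))
    (hfg : ∀ u, g (f u) = 0) (S : Finset ι) (T : Finset γ)
    (hT : ∀ c b, b ∈ S → c ∉ T → ∀ y : Vb b, g (Pi.single b y) c = 0)
    (CV : Finset ι) (CU : Finset κ)
    (hcov : ∀ b a, b ∈ S → b ∉ CV → a ∉ CU → ∀ x : Ua a, f (Pi.single a x) b = 0) :
    ∑ b ∈ S, finrank K (Vb b) ≤ finrank K (LinearMap.ker g ⧸ imInKer f g hfg) + ∑ c ∈ T, finrank K (Wc c)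
      + (∑ b ∈ CV, finrank K (Vb b) + ∑ a ∈ CU, finrank K (Ua a)) := by
  have hIN : ∀ v ∈ LinearMap.range (extOn K Vb S), g v ∈ LinearMap.range (extOn K Wc T) := by
    intro v hv
    rw [mem_range_extOn] at hv ⊢
    intro c hc
    refine apply_eq_zero_of_blocks K g v c (fun b => ?_)
    by_cases hb : b ∈ S
    · right; exact hT c b hb hc
    · left; exact hv b hb
  have h := sigmaH_floor_cover K f g hfg S (LinearMap.range (extOn K Wc T)) hIN CV CU hcov
  rw [finrank_range_extOn] at h
  exact h

end cover

section digits
/-! ## The cover digits of record, re-checked as closed arithmetic (machine `hallrank.py`, c4-1 `data/hall-table-g5.txt`; monad-3 g3 `THREE-TERM-DOOR-SH3X` §3) -/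

/-- RB16-plain c4c48e1eefdfc450, per mixed multidegree: `w(I*) = 62 400` (I* = all of V), `w(N(I*)) = 32 560`, min cover weight of `P_I d_in` = `28 944`
⇒ floor `896`; the three digits enter `sigmaH_floor_blocks` as `Σ_S`, `Σ_T`, cover weight. -/
theorem rb16_cover_floor : (62400 : ℤ) - 32560 - 28944 = 896 ∧ (0 : ℤ) < 896 := by norm_num

/-- TW32b-p32♯ a1a8405da9ba0240, per mixed multidegree: `w(I*) − w(N(I*)) = 10 720 − 5 008`, cover weight `2 496` ⇒ floor `3 216`. -/
theorem tw32b_cover_floor : (10720 : ℤ) - 5008 - 2496 = 3216 := by norm_num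

end digits

end Summit.HodgeConjecture.HodgeConjecture.Cruxes.BlochSeedDiscOne.SigmaRowCover
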